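import Literature.Analysis.FluidPDE.TaoAveragedQuaternionRotation
import Mathlib.MeasureTheory.Integral.Prod
import Mathlib.MeasureTheory.Integral.IntervalIntegral.Basic
import HarnessLib

/-!
# Torus averaging on the quaternion parameter space (Tao 2016, §3.7: the angles `θ₁, θ₂, θ₃`)

T. Tao, *Finite time blowup for an averaged three-dimensional Navier–Stokes equation*,
J. Amer. Math. Soc. **29** (2016), 601–674 = arXiv:1402.0290v3, §3.7 p. 19: the slice
`Σ_{ξ₁,ξ₂,ξ₃}` is parametrised by `(S, θ₁, θ₂, θ₃)` through the ansatz
`Rⱼ = S R^{θⱼ}_{ξ̃ⱼ} R_{j,ξ}` (3.19), and the representation (3.21) is an integral over the angles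
`(θ₁, θ₂, θ₃) ∈ (ℝ/2πℤ)³`.  In the quaternion parametrisation (`TaoAveragedQuaternionRotation.lean`)
the angle `θⱼ` acts on the parameter space `Q = ℍ × ℍ × ℍ` by *left multiplication of the `j`-th
quaternion by the unit quaternion `e^{θ v/2} = quatExp v θ`* (whose rotation is `R^θ_v`,
`qrotFun_quatExp`).  Since these are measure-preserving bijections of `Q`, **inserting an average
over the angles is free**: for every integrable `Ψ` on `Q`,

  `∫_Q Ψ(q) dq = ∫_Q (2π)⁻³ ∫₀^{2π}∫₀^{2π}∫₀^{2π} Ψ(t₃(θ₃) t₂(θ₂) t₁(θ₁) q) dθ₁ dθ₂ dθ₃ dq`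

(`integral_eq_integral_torusAverage`).  This file proves that identity (Fubini on
`[0,2π] × Q`, one angle at a time: `integral_eq_integral_average`), for a general measure-preserving
measurable flow, together with the slot actions `slotA`, `slotB`, `slotC` and their invariance
properties.  It is the measure-theoretic half of the fibre identity used in the proof of
`rotationAverage_jointWeight`; the algebraic half is `TaoAveragedFibreIdentity.lean`.

## References

* T. Tao, J. Amer. Math. Soc. 29 (2016), 601–674, arXiv:1402.0290v3, §3.7 (3.19)–(3.21) p. 19.
  Key `Tao2016AveragedNS`.
-/

noncomputable section

open Real MeasureTheory Quaternion Set intervalIntegral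
open scoped RealInnerProductSpace Quaternion ENNReal

namespace Literature.Analysis.FluidPDE.Tao2016

/-- Local notation for physical / frequency space `ℝ³`. -/
local notation "ℝ³" => EuclideanSpace ℝ (Fin 3)

attribute [local instance] quatMeasurableSpace quatBorelSpace

/-! ### A general averaging lemma: inserting an average over a measure-preserving flow -/

section Average

variable {α : Type*} [MeasurableSpace α] {μ : Measure α} [SFinite μ]
  {E : Type*} [NormedAddCommGroup E]

/-- **Integrability along a measure-preserving flow**: if each `T θ` preserves `μ` and
`(θ, x) ↦ T θ x` is measurable, then for integrable `Ψ` the function `(θ, x) ↦ Ψ(T θ x)` is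
integrable on `[a, b] × α`. [folklore] -/
theorem integrable_comp_flow (T : ℝ → α ≃ᵐ α) (hT : ∀ θ, MeasurePreserving (T θ) μ μ)
    (hTm : Measurable fun p : ℝ × α => T p.1 p.2) {Ψ : α → E} (hΨ : Integrable Ψ μ) (a b : ℝ) :
    Integrable (fun p : ℝ × α => Ψ (T p.1 p.2)) ((volume.restrict (Ioc a b)).prod μ) := by
  set ν : Measure ℝ := volume.restrict (Ioc a b) with hν
  haveI : IsFiniteMeasure ν := by
    rw [hν]; exact ⟨by simp [Real.volume_Ioc]⟩
  -- the flow map is quasi-measure-preserving from `ν × μ` to `μ`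
  have hqmp : Measure.QuasiMeasurePreserving (fun p : ℝ × α => T p.1 p.2) (ν.prod μ) μ := by
    refine ⟨hTm, Measure.AbsolutelyContinuous.mk fun s hs hμs => ?_⟩
    rw [Measure.map_apply hTm hs, Measure.prod_apply (hTm hs)]
    have : ∀ θ : ℝ, μ (Prod.mk θ ⁻¹' ((fun p : ℝ × α => T p.1 p.2) ⁻¹' s)) = 0 := by
      intro θ
      have hpre : Prod.mk θ ⁻¹' ((fun p : ℝ × α => T p.1 p.2) ⁻¹' s) = T θ ⁻¹' s := rfl
      rw [hpre, (hT θ).measure_preimage hs.nullMeasurableSet, hμs]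
    simp [this]
  refine ⟨hΨ.aestronglyMeasurable.comp_quasiMeasurePreserving hqmp, ?_⟩
  -- finite integral by Tonelli and invariance
  rw [hasFiniteIntegral_iff_enorm, lintegral_prod _ (by
    exact (hΨ.aestronglyMeasurable.comp_quasiMeasurePreserving hqmp).enorm)]
  have hinv : ∀ θ : ℝ, ∫⁻ x, ‖Ψ (T θ x)‖ₑ ∂μ = ∫⁻ x, ‖Ψ x‖ₑ ∂μ := fun θ =>
    (hT θ).lintegral_comp_emb (T θ).measurableEmbedding (fun x => ‖Ψ x‖ₑ)
  simp only [hinv, lintegral_const]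
  exact ENNReal.mul_lt_top hΨ.hasFiniteIntegral (measure_lt_top _ _)

/-- **Inserting an average over a measure-preserving flow**: for integrable `Ψ` and `a < b`,
`∫ Ψ dμ = (b-a)⁻¹ ∫ (∫ₐᵇ Ψ(T θ x) dθ) dμ(x)`. [folklore] -/
theorem integral_eq_integral_average [NormedSpace ℝ E] [CompleteSpace E] (T : ℝ → α ≃ᵐ α)
    (hT : ∀ θ, MeasurePreserving (T θ) μ μ)
    (hTm : Measurable fun p : ℝ × α => T p.1 p.2) {Ψ : α → E} (hΨ : Integrable Ψ μ) {a b : ℝ}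
    (hab : a < b) :
    ∫ x, Ψ x ∂μ = (b - a)⁻¹ • ∫ x, (∫ θ in a..b, Ψ (T θ x)) ∂μ := by
  have hint := integrable_comp_flow T hT hTm hΨ a b
  have h1 : ∫ x, (∫ θ in a..b, Ψ (T θ x)) ∂μ = ∫ θ in Ioc a b, ∫ x, Ψ (T θ x) ∂μ := by
    simp only [intervalIntegral.integral_of_le hab.le]
    rw [← integral_prod_symm _ hint, integral_prod _ hint]
  have h2 : ∀ θ : ℝ, ∫ x, Ψ (T θ x) ∂μ = ∫ x, Ψ x ∂μ := fun θ =>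
    (hT θ).integral_comp (T θ).measurableEmbedding Ψ
  rw [h1]
  simp only [h2]
  rw [setIntegral_const, Real.volume_real_Ioc_of_le hab.le, smul_smul, inv_mul_cancel₀ (by linarith), one_smul]

/-- The averaged function is again integrable. [folklore] -/
theorem integrable_average [NormedSpace ℝ E] (T : ℝ → α ≃ᵐ α) (hT : ∀ θ, MeasurePreserving (T θ) μ μ)
    (hTm : Measurable fun p : ℝ × α => T p.1 p.2) {Ψ : α → E} (hΨ : Integrable Ψ μ) {a b : ℝ}
    (hab : a ≤ b) : Integrable (fun x => ∫ θ in a..b, Ψ (T θ x)) μ := by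
  have hint := integrable_comp_flow T hT hTm hΨ a b
  simp only [intervalIntegral.integral_of_le hab]
  exact hint.integral_prod_right

end Average

/-! ### The three angle actions on `Q = ℍ × ℍ × ℍ` -/

section Slots

/-- Left multiplication of the **first** quaternion by a unit quaternion. [cite: Tao2016AveragedNS, §3.7 (3.19) p. 19] -/
def slotA {u : ℍ} (hu : ‖u‖ = 1) : (ℍ × ℍ × ℍ) ≃ᵐ (ℍ × ℍ × ℍ) :=
  MeasurableEquiv.prodCongr (quatLmul u hu).toHomeomorph.toMeasurableEquiv (MeasurableEquiv.refl _)

/-- Left multiplication of the **second** quaternion by a unit quaternion. [cite: Tao2016AveragedNS, §3.7 (3.19) p. 19] -/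
def slotB {u : ℍ} (hu : ‖u‖ = 1) : (ℍ × ℍ × ℍ) ≃ᵐ (ℍ × ℍ × ℍ) :=
  MeasurableEquiv.prodCongr (MeasurableEquiv.refl _)
    (MeasurableEquiv.prodCongr (quatLmul u hu).toHomeomorph.toMeasurableEquiv (MeasurableEquiv.refl _))

/-- Left multiplication of the **third** quaternion by a unit quaternion. [cite: Tao2016AveragedNS, §3.7 (3.19) p. 19] -/
def slotC {u : ℍ} (hu : ‖u‖ = 1) : (ℍ × ℍ × ℍ) ≃ᵐ (ℍ × ℍ × ℍ) :=
  MeasurableEquiv.prodCongr (MeasurableEquiv.refl _)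
    (MeasurableEquiv.prodCongr (MeasurableEquiv.refl _) (quatLmul u hu).toHomeomorph.toMeasurableEquiv)

/-- `slotA` acts by `(a,b,c) ↦ (ua, b, c)`. [folklore] -/
@[simp] theorem slotA_apply {u : ℍ} (hu : ‖u‖ = 1) (q : ℍ × ℍ × ℍ) : slotA hu q = (u * q.1, q.2) := rfl

/-- `slotB` acts by `(a,b,c) ↦ (a, ub, c)`. [folklore] -/
@[simp] theorem slotB_apply {u : ℍ} (hu : ‖u‖ = 1) (q : ℍ × ℍ × ℍ) : slotB hu q = (q.1, u * q.2.1, q.2.2) := rfl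

/-- `slotC` acts by `(a,b,c) ↦ (a, b, uc)`. [folklore] -/
@[simp] theorem slotC_apply {u : ℍ} (hu : ‖u‖ = 1) (q : ℍ × ℍ × ℍ) : slotC hu q = (q.1, q.2.1, u * q.2.2) := rfl

/-- The slot actions preserve Lebesgue measure on `Q`. [folklore] -/
theorem measurePreserving_slotA {u : ℍ} (hu : ‖u‖ = 1) : MeasurePreserving (slotA hu) volume volume := by
  have h : MeasurePreserving (Prod.map (quatLmul u hu) (id : ℍ × ℍ → ℍ × ℍ)) volume volume := by
    rw [Measure.volume_eq_prod]
    exact (quatLmul u hu).measurePreserving.prod (MeasurePreserving.id volume)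
  convert h using 1
  funext q; rfl

/-- The slot actions preserve Lebesgue measure on `Q`. [folklore] -/
theorem measurePreserving_slotB {u : ℍ} (hu : ‖u‖ = 1) : MeasurePreserving (slotB hu) volume volume := by
  have h : MeasurePreserving (Prod.map (id : ℍ → ℍ) (Prod.map (quatLmul u hu) (id : ℍ → ℍ))) volume volume := by
    rw [Measure.volume_eq_prod, Measure.volume_eq_prod]
    exact (MeasurePreserving.id volume).prod ((quatLmul u hu).measurePreserving.prod (MeasurePreserving.id volume))
  convert h using 1
  funext q; rfl

/-- The slot actions preserve Lebesgue measure on `Q`. [folklore] -/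
theorem measurePreserving_slotC {u : ℍ} (hu : ‖u‖ = 1) : MeasurePreserving (slotC hu) volume volume := by
  have h : MeasurePreserving (Prod.map (id : ℍ → ℍ) (Prod.map (id : ℍ → ℍ) (quatLmul u hu))) volume volume := by
    rw [Measure.volume_eq_prod, Measure.volume_eq_prod]
    exact (MeasurePreserving.id volume).prod ((MeasurePreserving.id volume).prod (quatLmul u hu).measurePreserving)
  convert h using 1
  funext q; rfl

/-- The half-angle quaternion depends continuously on the angle. [folklore] -/
theorem continuous_quatExp (v : ℝ³) : Continuous fun θ : ℝ => quatExp v θ := by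
  unfold quatExp
  exact ((Quaternion.continuous_coe).comp (Real.continuous_cos.comp (continuous_id.div_const 2))).add
    ((Real.continuous_sin.comp (continuous_id.div_const 2)).smul continuous_const)

variable {v : ℝ³} (hv : ‖v‖ = 1)

/-- The angle flows `θ ↦ slot·(quatExp v θ)` are jointly measurable. [folklore] -/
theorem measurable_slotA_flow : Measurable fun p : ℝ × (ℍ × ℍ × ℍ) => slotA (norm_quatExp hv p.1) p.2 := by
  simp only [slotA_apply]
  exact (((continuous_quatExp v).comp continuous_fst).mul (continuous_fst.comp continuous_snd)).measurable.prodMk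
    (measurable_snd.comp measurable_snd)

/-- The angle flows are jointly measurable. [folklore] -/
theorem measurable_slotB_flow : Measurable fun p : ℝ × (ℍ × ℍ × ℍ) => slotB (norm_quatExp hv p.1) p.2 := by
  simp only [slotB_apply]
  exact (measurable_fst.comp measurable_snd).prodMk
    ((((continuous_quatExp v).comp continuous_fst).mul
      ((continuous_fst.comp continuous_snd).comp continuous_snd)).measurable.prodMk
      ((measurable_snd.comp measurable_snd).comp measurable_snd))

/-- The angle flows are jointly measurable. [folklore] -/
theorem measurable_slotC_flow : Measurable fun p : ℝ × (ℍ × ℍ × ℍ) => slotC (norm_quatExp hv p.1) p.2 := by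
  simp only [slotC_apply]
  exact (measurable_fst.comp measurable_snd).prodMk
    (((measurable_fst.comp measurable_snd).comp measurable_snd).prodMk
      (((continuous_quatExp v).comp continuous_fst).mul
        ((continuous_snd.comp continuous_snd).comp continuous_snd)).measurable)

end Slots

/-! ### The triple torus average -/

/-- **Inserting the torus average** (Tao 2016, §3.7: the angle variables of (3.20)–(3.21)): for
unit axes `v₁, v₂, v₃` and every integrable `Ψ` on `Q = ℍ³`,
`∫_Q Ψ = (2π)⁻³ ∫_Q ∫₀^{2π}∫₀^{2π}∫₀^{2π} Ψ(t_A(θ₃) t_C(θ₂) t_B(θ₁) q) dθ₁ dθ₂ dθ₃ dq`, where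
`t_B(θ)`, `t_C(θ)`, `t_A(θ)` multiply the quaternion of slot `1, 2, 3` on the left by
`e^{θvⱼ/2}`. [cite: Tao2016AveragedNS, §3.7 (3.20)–(3.21) p. 19] -/
theorem integral_eq_integral_torusAverage {E : Type*} [NormedAddCommGroup E] [NormedSpace ℝ E] [CompleteSpace E]
    {v₁ v₂ v₃ : ℝ³} (hv₁ : ‖v₁‖ = 1) (hv₂ : ‖v₂‖ = 1) (hv₃ : ‖v₃‖ = 1)
    {Ψ : ℍ × ℍ × ℍ → E} (hΨ : Integrable Ψ volume) :
    ∫ q, Ψ q = ((2 * π)⁻¹) ^ 3 • ∫ q, ∫ θ₃ in (0 : ℝ)..2 * π, ∫ θ₂ in (0 : ℝ)..2 * π, ∫ θ₁ in (0 : ℝ)..2 * π,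
      Ψ (slotB (norm_quatExp hv₁ θ₁) (slotC (norm_quatExp hv₂ θ₂) (slotA (norm_quatExp hv₃ θ₃) q))) := by
  have h2π : (0 : ℝ) < 2 * π := by positivity
  -- slot B (innermost angle `θ₁`)
  set Ψ₁ : ℍ × ℍ × ℍ → E := fun q => ∫ θ₁ in (0 : ℝ)..2 * π, Ψ (slotB (norm_quatExp hv₁ θ₁) q) with hΨ₁
  have e1 : ∫ q, Ψ q = (2 * π)⁻¹ • ∫ q, Ψ₁ q := by
    rw [integral_eq_integral_average (fun θ => slotB (norm_quatExp hv₁ θ)) (fun θ => measurePreserving_slotB _)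
      (measurable_slotB_flow hv₁) hΨ h2π, sub_zero]
  have hΨ₁i : Integrable Ψ₁ volume :=
    integrable_average (fun θ => slotB (norm_quatExp hv₁ θ)) (fun θ => measurePreserving_slotB _)
      (measurable_slotB_flow hv₁) hΨ h2π.le
  -- slot C (`θ₂`)
  set Ψ₂ : ℍ × ℍ × ℍ → E := fun q => ∫ θ₂ in (0 : ℝ)..2 * π, Ψ₁ (slotC (norm_quatExp hv₂ θ₂) q) with hΨ₂
  have e2 : ∫ q, Ψ₁ q = (2 * π)⁻¹ • ∫ q, Ψ₂ q := by
    rw [integral_eq_integral_average (fun θ => slotC (norm_quatExp hv₂ θ)) (fun θ => measurePreserving_slotC _)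
      (measurable_slotC_flow hv₂) hΨ₁i h2π, sub_zero]
  have hΨ₂i : Integrable Ψ₂ volume :=
    integrable_average (fun θ => slotC (norm_quatExp hv₂ θ)) (fun θ => measurePreserving_slotC _)
      (measurable_slotC_flow hv₂) hΨ₁i h2π.le
  -- slot A (`θ₃`, outermost)
  have e3 : ∫ q, Ψ₂ q = (2 * π)⁻¹ • ∫ q, ∫ θ₃ in (0 : ℝ)..2 * π, Ψ₂ (slotA (norm_quatExp hv₃ θ₃) q) := by
    rw [integral_eq_integral_average (fun θ => slotA (norm_quatExp hv₃ θ)) (fun θ => measurePreserving_slotA _)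
      (measurable_slotA_flow hv₃) hΨ₂i h2π, sub_zero]
  rw [e1, e2, e3, smul_smul, smul_smul, ← pow_two, ← pow_succ]

end Literature.Analysis.FluidPDE.Tao2016
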